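import Mathlib.NumberTheory.NumberField.Units.Regulator
import Literature.NumberTheory.QuadraticFields.QuadraticDedekindZeta
import Literature.NumberTheory.QuadraticFields.LatticeSumPrincipal
import HarnessLib

/-!
# Units and regulators of the real quadratic fields of discriminant `21` and `33`

Topic `NumberTheory/QuadraticFields`, namespace `Literature.NumberTheory.QuadraticFields.Quadratic`.
Everything here is PROVED (theorems only, plus the two explicit units as definitions).

For Baker's solution of the class number one problem (Baker 1975, Ch. 5 §4; Baker–Wüstholz 2007,
§3.1: "`L(1,χ) = 2h(k) log ε_k/√k` … where `ε_k` is the fundamental unit in `ℚ(√k)`", applied with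
`k = 21, 33`) one needs the regulators of `ℚ(√21)` and `ℚ(√33)`:

* `R(ℚ(√21)) = log ((5 + √21)/2)`, `R(ℚ(√33)) = log (23 + 4√33)`.

We work, as elsewhere in this directory, with an abstract number field `K` of degree `2`, an
integral basis `(1, ω)` with `ω² = m + tω` and `d_K = t² + 4m` (`HeegnerCondition.lean`). For a
real embedding `σ` and a unit `u = x + yω` one has `N(u) = x² + txy - my² = ±1`, i.e.
`X² - d_K y² = ±4` with `X = 2x + ty`, and `σ(u) = (X + yδ)/2`, `δ = σ(2ω - t) = ±√d_K`; if
`σ(u) > 1` then `X ≥ 1` and `yδ = |y|√d_K > 0` (`exists_sq_sub_eq_of_one_lt`). The finitely many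
small solutions of `X² - 21Y² = ±4`, `X² - 33Y² = ±4` then give the minimality of
`ε₂₁ = (5 + √21)/2` and `ε₃₃ = 23 + 4√33` among units `> 1` (`le_of_one_lt_21`, `le_of_one_lt_33`),
whence the regulators through Mathlib's `regulator_eq_det` (a `1 × 1` determinant) and
`regOfFamily_div_regulator` (`regulator_eq_log_21`, `regulator_eq_log_33`). Also: a real quadratic
field has `w_K = 2` (`torsionOrder_eq_two_of_discr_pos`).

## References

* A. Baker, *Transcendental Number Theory* (1975), Ch. 5 §4. [Baker1975]
* A. Baker, G. Wüstholz, *Logarithmic Forms and Diophantine Geometry* (2007), §3.1 p. 36.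
  [BakerWustholz2007]
* D. A. Cox, *Primes of the form x² + ny²*, 2nd ed. (2013), §7.A (norm form, units of orders).
  [Cox2013]
-/

noncomputable section

open Module NumberField NumberField.InfinitePlace NumberField.Units

namespace Literature.NumberTheory.QuadraticFields.Quadratic

variable {K : Type*} [Field K] [NumberField K]

/-! ### Real embeddings of a real quadratic field -/

/-- A quadratic field of positive discriminant has only real places. [folklore] -/
theorem isReal_of_discr_pos (h2 : finrank ℚ K = 2) (hd : 0 < NumberField.discr K)
    (w : InfinitePlace K) : IsReal w := by
  classical
  obtain ⟨_, h0⟩ := nrRealPlaces_eq_two_and_nrComplexPlaces_eq_zero h2 hd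
  by_contra hw
  rw [not_isReal_iff_isComplex] at hw
  have : 0 < nrComplexPlaces K := by
    rw [nrComplexPlaces]
    exact Fintype.card_pos_iff.mpr ⟨⟨w, hw⟩⟩
  omega

/-- A quadratic field of positive discriminant has a real embedding. [folklore] -/
theorem exists_ringHom_real (h2 : finrank ℚ K = 2) (hd : 0 < NumberField.discr K) :
    Nonempty (K →+* ℝ) := by
  obtain ⟨w⟩ : Nonempty (InfinitePlace K) := inferInstance
  exact ⟨(isReal_iff.mp (isReal_of_discr_pos h2 hd w)).embedding⟩

/-- A quadratic field of positive discriminant has unit rank `1`. [folklore] -/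
theorem rank_eq_one_of_discr_pos (h2 : finrank ℚ K = 2) (hd : 0 < NumberField.discr K) :
    rank K = 1 := by
  obtain ⟨h1, h0⟩ := nrRealPlaces_eq_two_and_nrComplexPlaces_eq_zero h2 hd
  rw [rank, card_eq_nrRealPlaces_add_nrComplexPlaces, h1, h0]

/-- **A real quadratic field has exactly two roots of unity** (`w_K = 2`): under a real
embedding a root of unity goes to a real root of unity, i.e. to `±1`. [folklore] -/
theorem torsionOrder_eq_two_of_discr_pos (h2 : finrank ℚ K = 2) (hd : 0 < NumberField.discr K) :
    torsionOrder K = 2 := by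
  classical
  obtain ⟨σ⟩ := exists_ringHom_real h2 hd
  have htor : ∀ x : torsion K, (x : (𝓞 K)ˣ) = 1 ∨ (x : (𝓞 K)ˣ) = -1 := by
    intro x
    obtain ⟨n, hn, hx⟩ := isOfFinOrder_iff_pow_eq_one.mp ((CommGroup.mem_torsion _).mp x.2)
    set r : ℝ := σ (((x : (𝓞 K)ˣ) : 𝓞 K) : K) with hr
    have hrn : r ^ n = 1 := by
      have := congrArg (fun u : (𝓞 K)ˣ => σ ((u : 𝓞 K) : K)) hx
      simpa [Units.val_pow_eq_pow_val] using this
    have habs : |r| = 1 := by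
      have h := congrArg (fun y : ℝ => |y|) hrn
      simp only [abs_pow, abs_one] at h
      exact (pow_eq_one_iff_of_nonneg (abs_nonneg r) hn.ne').mp h
    have hinj : Function.Injective (fun z : 𝓞 K => σ (z : K)) :=
      σ.injective.comp RingOfIntegers.coe_injective
    rcases (abs_eq zero_le_one).mp habs with h | h
    · left
      apply Units.ext
      apply hinj
      simpa [hr] using h
    · right
      apply Units.ext
      apply hinj
      simpa [hr] using h
  let _ := Fintype.ofFinite (torsion K)
  rw [torsionOrder, Nat.card_eq_fintype_card]
  refine (Finset.card_eq_two.2 ⟨1, ⟨-1, neg_one_mem_torsion⟩,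
    by simp [← Subtype.coe_ne_coe], Finset.ext fun x ↦ ⟨fun _ ↦ ?_, fun _ ↦ Finset.mem_univ _⟩⟩)
  rw [Finset.mem_insert, Finset.mem_singleton, ← Subtype.val_inj, ← Subtype.val_inj]
  exact htor x

/-! ### Units under a real embedding -/

section Embedding

variable (b : Basis (Fin 2) ℤ (𝓞 K)) (hb : b 0 = 1) {t m : ℤ}
variable (hω : b 1 * b 1 = (m : 𝓞 K) + (t : 𝓞 K) * b 1) (σ : K →+* ℝ)

omit [NumberField K] in
/-- `σ(ω)² = m + tσ(ω)`. [folklore] -/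
theorem ringHom_omega_sq (hω : b 1 * b 1 = (m : 𝓞 K) + (t : 𝓞 K) * b 1) (σ : K →+* ℝ) :
    σ (b 1 : K) ^ 2 = m + t * σ (b 1 : K) := by
  have h := congrArg (σ.comp (algebraMap (𝓞 K) K)) hω
  simp only [map_mul, map_add, map_intCast, RingHom.comp_apply] at h
  rw [sq]
  exact h

omit [NumberField K] in
/-- `δ = σ(2ω - t)` has `δ² = t² + 4m = d_K`. [folklore] -/
theorem ringHom_delta_sq (hω : b 1 * b 1 = (m : 𝓞 K) + (t : 𝓞 K) * b 1) (σ : K →+* ℝ) :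
    (2 * σ (b 1 : K) - t) ^ 2 = (t ^ 2 + 4 * m : ℤ) := by
  have h := ringHom_omega_sq b hω σ
  push_cast
  nlinarith [h]

omit [NumberField K] in
include hb in
/-- The norm equation of a unit: `u = x + yω` has `x² + txy - my² = ±1`. [cite: Cox2013, §7.A] -/
theorem normForm_unit (hω : b 1 * b 1 = (m : 𝓞 K) + (t : 𝓞 K) * b 1) (u : (𝓞 K)ˣ) :
    (b.repr (u : 𝓞 K) 0) ^ 2 + t * (b.repr (u : 𝓞 K) 0) * (b.repr (u : 𝓞 K) 1) -
        m * (b.repr (u : 𝓞 K) 1) ^ 2 = 1 ∨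
      (b.repr (u : 𝓞 K) 0) ^ 2 + t * (b.repr (u : 𝓞 K) 0) * (b.repr (u : 𝓞 K) 1) -
        m * (b.repr (u : 𝓞 K) 1) ^ 2 = -1 := by
  have hxy := eq_repr_add_repr_mul_of_basis b hb (u : 𝓞 K)
  have hunit : IsUnit (Algebra.norm ℤ (u : 𝓞 K)) := u.isUnit.map _
  rw [hxy, norm_intCast_add_intCast_mul b hb hω, Int.isUnit_iff] at hunit
  exact hunit

omit [NumberField K] in
include hb in
/-- The value of a unit under a real embedding: `σ(u) = x + yσ(ω)`. [folklore] -/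
theorem ringHom_unit_eq (u : (𝓞 K)ˣ) :
    σ ((u : 𝓞 K) : K) = (b.repr (u : 𝓞 K) 0 : ℝ) + (b.repr (u : 𝓞 K) 1 : ℝ) * σ (b 1 : K) := by
  have hxy := eq_repr_add_repr_mul_of_basis b hb (u : 𝓞 K)
  have h := congrArg (σ.comp (algebraMap (𝓞 K) K)) hxy
  simp only [map_mul, map_add, map_intCast, RingHom.comp_apply] at h
  exact h

omit [NumberField K] in
include hb in
/-- **Units greater than one.** If `σ(u) > 1` for a unit `u` and a real embedding `σ`, then
`σ(u) = (X + Y√d_K)/2` with integers `X, Y ≥ 1` and `X² - d_K Y² = ±4`. [cite: Cox2013, §7.A] -/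
theorem exists_sq_sub_eq_of_one_lt (hω : b 1 * b 1 = (m : 𝓞 K) + (t : 𝓞 K) * b 1)
    (σ : K →+* ℝ) (u : (𝓞 K)ˣ) (hu : 1 < σ ((u : 𝓞 K) : K)) :
    ∃ X Y : ℤ, 1 ≤ X ∧ 1 ≤ Y ∧
      (X ^ 2 - (t ^ 2 + 4 * m) * Y ^ 2 = 4 ∨ X ^ 2 - (t ^ 2 + 4 * m) * Y ^ 2 = -4) ∧
      σ ((u : 𝓞 K) : K) = (X + Y * Real.sqrt ((t ^ 2 + 4 * m : ℤ) : ℝ)) / 2 := by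
  set x : ℤ := b.repr (u : 𝓞 K) 0 with hx
  set y : ℤ := b.repr (u : 𝓞 K) 1 with hy
  set w : ℝ := σ (b 1 : K) with hw
  set δ : ℝ := 2 * w - t with hδ
  set d : ℤ := t ^ 2 + 4 * m with hd
  have hδ2 : δ ^ 2 = (d : ℝ) := ringHom_delta_sq b hω σ
  have hval : σ ((u : 𝓞 K) : K) = x + y * w := ringHom_unit_eq b hb σ u
  have hN := normForm_unit b hb hω u
  rw [← hx, ← hy] at hN
  set X : ℤ := 2 * x + t * y with hX
  -- `σ(u) = (X + yδ)/2` and the conjugate value `(X - yδ)/2`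
  have hval' : σ ((u : 𝓞 K) : K) = ((X : ℝ) + y * δ) / 2 := by
    rw [hval, hX, hδ]; push_cast; ring
  set v : ℝ := σ ((u : 𝓞 K) : K) with hv
  set v' : ℝ := ((X : ℝ) - y * δ) / 2 with hv'
  have hprod : v * v' = ((X ^ 2 - d * y ^ 2 : ℤ) : ℝ) / 4 := by
    rw [hval', hv']; push_cast
    have : (y : ℝ) ^ 2 * δ ^ 2 = (d : ℝ) * y ^ 2 := by rw [hδ2]; ring
    nlinarith [this]
  have hNX : X ^ 2 - d * y ^ 2 = 4 ∨ X ^ 2 - d * y ^ 2 = -4 := by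
    rcases hN with h | h
    · left; rw [hX, hd]; linear_combination 4 * h
    · right; rw [hX, hd]; linear_combination 4 * h
  have hvv' : v * v' = 1 ∨ v * v' = -1 := by
    rcases hNX with h | h
    · left; rw [hprod, h]; norm_num
    · right; rw [hprod, h]; norm_num
  have hv1 : 1 < v := hu
  have hv'abs : |v'| < 1 := by
    have hvpos : 0 < v := by linarith
    have : |v * v'| = 1 := by rcases hvv' with h | h <;> simp [h]
    rw [abs_mul, abs_of_pos hvpos] at this
    have hv'eq : |v'| = 1 / v := by field_simp; linarith
    rw [hv'eq, div_lt_one hvpos]; exact hv1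
  have hsum : v + v' = X := by rw [hval', hv']; ring
  have hdiff : v - v' = y * δ := by rw [hval', hv']; ring
  have hXpos : (0 : ℝ) < X := by
    have := abs_lt.mp hv'abs; linarith
  have hyδpos : 0 < (y : ℝ) * δ := by
    have := abs_lt.mp hv'abs; linarith
  -- `yδ = |y| √d`
  have hd0 : (0 : ℝ) ≤ d := by rw [← hδ2]; positivity
  have hyδ : (y : ℝ) * δ = |(y : ℝ)| * Real.sqrt (d : ℝ) := by
    have h1 : ((y : ℝ) * δ) ^ 2 = (|(y : ℝ)| * Real.sqrt (d : ℝ)) ^ 2 := by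
      rw [mul_pow, mul_pow, sq_abs, Real.sq_sqrt hd0, hδ2]
    have h2 : 0 ≤ |(y : ℝ)| * Real.sqrt (d : ℝ) := by positivity
    nlinarith [sq_nonneg ((y : ℝ) * δ - |(y : ℝ)| * Real.sqrt d),
      sq_nonneg ((y : ℝ) * δ + |(y : ℝ)| * Real.sqrt d)]
  have hy0 : y ≠ 0 := by
    rintro h0
    rw [h0] at hyδpos; simp at hyδpos
  refine ⟨X, |y|, by exact_mod_cast hXpos, Int.one_le_abs hy0, ?_, ?_⟩
  · rwa [sq_abs]
  · rw [hval', hyδ, Int.cast_abs]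

end Embedding

/-! ### The two fields: minimality of `(5 + √21)/2` and `23 + 4√33` -/

/-- `X² - 21Y² = ±4` with `X, Y ≥ 1` forces `(X + Y√21)/2 ≥ (5 + √21)/2`. [folklore] -/
theorem sqrt21_min {X Y : ℤ} (hX : 1 ≤ X) (hY : 1 ≤ Y)
    (h : X ^ 2 - 21 * Y ^ 2 = 4 ∨ X ^ 2 - 21 * Y ^ 2 = -4) :
    (5 + Real.sqrt 21) / 2 ≤ (X + Y * Real.sqrt 21) / 2 := by
  have hs : (4 : ℝ) < Real.sqrt 21 := by
    rw [show (4 : ℝ) = Real.sqrt 16 by rw [show (16 : ℝ) = 4 ^ 2 by norm_num, Real.sqrt_sq (by norm_num)]]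
    exact Real.sqrt_lt_sqrt (by norm_num) (by norm_num)
  have hs0 : (0 : ℝ) ≤ Real.sqrt 21 := Real.sqrt_nonneg _
  rcases eq_or_lt_of_le hY with hY1 | hY2
  · -- `Y = 1`: `X² = 25` or `17`
    subst hY1
    have hX5 : X = 5 := by
      rcases h with h | h
      · have : X ^ 2 = 25 := by linarith
        nlinarith [sq_nonneg (X - 5), sq_nonneg (X + 5)]
      · have h17 : X ^ 2 = 17 := by linarith
        exfalso
        have hX4 : X ≤ 4 := by nlinarith
        have hX5 : 5 ≤ X ∨ X ≤ 4 := by omega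
        interval_cases X <;> omega
    subst hX5; push_cast; linarith
  · have hY2' : (2 : ℝ) ≤ Y := by exact_mod_cast hY2
    have hX1 : (1 : ℝ) ≤ X := by exact_mod_cast hX
    nlinarith

/-- `X² - 33Y² = ±4` with `X, Y ≥ 1` forces `(X + Y√33)/2 ≥ 23 + 4√33`. [folklore] -/
theorem sqrt33_min {X Y : ℤ} (hX : 1 ≤ X) (hY : 1 ≤ Y)
    (h : X ^ 2 - 33 * Y ^ 2 = 4 ∨ X ^ 2 - 33 * Y ^ 2 = -4) :
    23 + 4 * Real.sqrt 33 ≤ (X + Y * Real.sqrt 33) / 2 := by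
  have hs : (5 : ℝ) < Real.sqrt 33 := by
    rw [show (5 : ℝ) = Real.sqrt 25 by rw [show (25 : ℝ) = 5 ^ 2 by norm_num, Real.sqrt_sq (by norm_num)]]
    exact Real.sqrt_lt_sqrt (by norm_num) (by norm_num)
  have hs6 : Real.sqrt 33 < 6 := by
    rw [show (6 : ℝ) = Real.sqrt 36 by rw [show (36 : ℝ) = 6 ^ 2 by norm_num, Real.sqrt_sq (by norm_num)]]
    exact Real.sqrt_lt_sqrt (by norm_num) (by norm_num)
  have hs0 : (0 : ℝ) ≤ Real.sqrt 33 := Real.sqrt_nonneg _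
  by_cases hY8 : Y ≤ 8
  · -- small `Y`: only `(X, Y) = (46, 8)`
    have hX2 : X ^ 2 ≤ 2116 := by rcases h with h | h <;> nlinarith
    have hXb : X ≤ 46 := by nlinarith
    have key : X = 46 ∧ Y = 8 := by
      interval_cases Y <;> · rcases h with h | h <;> · have := h; interval_cases X <;> omega
    obtain ⟨rfl, rfl⟩ := key
    push_cast; linarith
  · -- `Y ≥ 9`: then `X ≥ 52`
    push Not at hY8
    have hY9 : 9 ≤ Y := hY8
    have hX2 : 2669 ≤ X ^ 2 := by rcases h with h | h <;> nlinarith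
    have hX52 : 52 ≤ X := by nlinarith
    have hY9' : (9 : ℝ) ≤ Y := by exact_mod_cast hY9
    have hX52' : (52 : ℝ) ≤ X := by exact_mod_cast hX52
    nlinarith


/-! ### From minimality to the regulator -/

section Regulator

variable (b : Basis (Fin 2) ℤ (𝓞 K)) (hb : b 0 = 1) {t m : ℤ}

include hb in
/-- **Units away from `1` are at least `ε₀` in size.** If every solution of `X² - d_K Y² = ±4`
with `X, Y ≥ 1` has `(X + Y√d_K)/2 ≥ ε₀`, then every unit `u` and real embedding `σ` with
`|σ(u)| ≠ 1` satisfy `|log |σ(u)|| ≥ log ε₀`. [cite: Cox2013, §7.A] -/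
theorem log_le_abs_log_of_minimal (hω : b 1 * b 1 = (m : 𝓞 K) + (t : 𝓞 K) * b 1) {ε₀ : ℝ}
    (hε₀ : 0 < ε₀)
    (hmin : ∀ X Y : ℤ, 1 ≤ X → 1 ≤ Y →
      (X ^ 2 - (t ^ 2 + 4 * m) * Y ^ 2 = 4 ∨ X ^ 2 - (t ^ 2 + 4 * m) * Y ^ 2 = -4) →
      ε₀ ≤ (X + Y * Real.sqrt ((t ^ 2 + 4 * m : ℤ) : ℝ)) / 2)
    (σ : K →+* ℝ) (u : (𝓞 K)ˣ) (hu : |σ ((u : 𝓞 K) : K)| ≠ 1) :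
    Real.log ε₀ ≤ |Real.log (|σ ((u : 𝓞 K) : K)|)| := by
  -- a unit `u'` with `σ(u') > 1` is `≥ ε₀`
  have key : ∀ u' : (𝓞 K)ˣ, 1 < σ ((u' : 𝓞 K) : K) → ε₀ ≤ σ ((u' : 𝓞 K) : K) := by
    intro u' hu'
    obtain ⟨X, Y, hX, hY, hXY, hval⟩ := exists_sq_sub_eq_of_one_lt b hb hω σ u' hu'
    rw [hval]; exact hmin X Y hX hY hXY
  -- the embedding on units
  set τ : (𝓞 K)ˣ →* ℝ := ((σ : K →* ℝ).comp ((algebraMap (𝓞 K) K : 𝓞 K →* K))).comp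
    (Units.coeHom (𝓞 K)) with hτ
  have hτu : ∀ u' : (𝓞 K)ˣ, τ u' = σ ((u' : 𝓞 K) : K) := fun u' => rfl
  have hneg : ∀ u' : (𝓞 K)ˣ, σ (((-u' : (𝓞 K)ˣ) : 𝓞 K) : K) = -σ ((u' : 𝓞 K) : K) := by
    intro u'
    rw [Units.val_neg]; push_cast; rw [map_neg]
  have hinv : ∀ u' : (𝓞 K)ˣ, σ (((u'⁻¹ : (𝓞 K)ˣ) : 𝓞 K) : K) = (σ ((u' : 𝓞 K) : K))⁻¹ := by
    intro u'
    rw [← hτu, ← hτu, map_inv]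
  set v : ℝ := σ ((u : 𝓞 K) : K) with hv
  have hv0 : v ≠ 0 := by
    intro h0
    have := map_mul τ u u⁻¹
    rw [mul_inv_cancel, map_one, hτu, ← hv, h0, zero_mul] at this
    exact one_ne_zero this
  rcases lt_or_gt_of_ne hu with hlt | hgt
  · -- `|v| < 1`: use `±u⁻¹`
    have hvpos : 0 < |v| := abs_pos.mpr hv0
    have h1 : 1 < |v|⁻¹ := (one_lt_inv₀ hvpos).mpr hlt
    have hε : ε₀ ≤ |v|⁻¹ := by
      rcases lt_or_gt_of_ne hv0 with hneg' | hpos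
      · have h2 : 1 < σ (((-u⁻¹ : (𝓞 K)ˣ) : 𝓞 K) : K) := by
          rw [hneg, hinv, ← hv, abs_of_neg hneg', neg_inv] at *; exact h1
        have := key (-u⁻¹) h2
        rwa [hneg, hinv, ← hv, neg_inv, ← abs_of_neg hneg'] at this
      · have h2 : 1 < σ (((u⁻¹ : (𝓞 K)ˣ) : 𝓞 K) : K) := by
          rw [hinv, ← hv, abs_of_pos hpos] at *; exact h1
        have := key u⁻¹ h2
        rwa [hinv, ← hv, ← abs_of_pos hpos] at this
    calc Real.log ε₀ ≤ Real.log |v|⁻¹ := Real.log_le_log (by linarith) hε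
      _ = |Real.log (|v|)| := by
          rw [Real.log_inv, abs_of_neg (Real.log_neg hvpos hlt)]
  · -- `|v| > 1`: use `±u`
    have hε : ε₀ ≤ |v| := by
      rcases lt_or_gt_of_ne hv0 with hneg' | hpos
      · have h2 : 1 < σ (((-u : (𝓞 K)ˣ) : 𝓞 K) : K) := by
          rw [hneg, ← hv, ← abs_of_neg hneg']; exact hgt
        have := key (-u) h2
        rwa [hneg, ← hv, ← abs_of_neg hneg'] at this
      · have h2 : 1 < σ (((u : (𝓞 K)ˣ) : 𝓞 K) : K) := by
          rw [← hv, ← abs_of_pos hpos]; exact hgt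
        have := key u h2
        rwa [← hv, ← abs_of_pos hpos] at this
    calc Real.log ε₀ ≤ Real.log |v| := Real.log_le_log (by linarith) hε
      _ = |Real.log (|v|)| := by rw [abs_of_pos (Real.log_pos hgt)]

omit [NumberField K] in
/-- The value of a real place is `|σ(x)|` for the corresponding real embedding. [folklore] -/
theorem infinitePlace_apply_eq_abs {w : InfinitePlace K} (hw : IsReal w) (x : K) :
    w x = |(isReal_iff.mp hw).embedding x| := by
  rw [← norm_embedding_eq, ← Real.norm_eq_abs, ← Complex.norm_real,
    ComplexEmbedding.IsReal.coe_embedding_apply]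

include hb in
/-- **The regulator of a real quadratic field from a minimal unit.** Let `K` be real quadratic
(`d_K = t² + 4m > 0`), suppose every solution of `X² - d_K Y² = ±4` with `X, Y ≥ 1` has
`(X + Y√d_K)/2 ≥ ε₀ > 1`, and let `ε` be a unit with `|log |σ ε|| = log ε₀` for every real
embedding `σ`. Then `R_K = log ε₀`. [cite: Cox2013, §7.A] -/
theorem regulator_eq_log_of_minimal (h2 : finrank ℚ K = 2) (hd : 0 < NumberField.discr K)
    (hω : b 1 * b 1 = (m : 𝓞 K) + (t : 𝓞 K) * b 1) {ε₀ : ℝ} (hε₀ : 1 < ε₀)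
    (hmin : ∀ X Y : ℤ, 1 ≤ X → 1 ≤ Y →
      (X ^ 2 - (t ^ 2 + 4 * m) * Y ^ 2 = 4 ∨ X ^ 2 - (t ^ 2 + 4 * m) * Y ^ 2 = -4) →
      ε₀ ≤ (X + Y * Real.sqrt ((t ^ 2 + 4 * m : ℤ) : ℝ)) / 2)
    (ε : (𝓞 K)ˣ) (hε : ∀ σ : K →+* ℝ, |Real.log (|σ ((ε : 𝓞 K) : K)|)| = Real.log ε₀) :
    regulator K = Real.log ε₀ := by
  classical
  have hrank : rank K = 1 := rank_eq_one_of_discr_pos h2 hd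
  have hreal : ∀ w : InfinitePlace K, IsReal w := isReal_of_discr_pos h2 hd
  set w' : InfinitePlace K := Classical.arbitrary _ with hw'
  have hc : Fintype.card {w : InfinitePlace K // w ≠ w'} = rank K := by
    rw [Fintype.card_subtype_compl, Fintype.card_subtype_eq, rank]
  have hc1 : Fintype.card {w : InfinitePlace K // w ≠ w'} = 1 := hc.trans hrank
  set e : {w : InfinitePlace K // w ≠ w'} ≃ Fin (rank K) := Fintype.equivFinOfCardEq hc with he
  obtain ⟨k⟩ : Nonempty {w : InfinitePlace K // w ≠ w'} := Fintype.card_pos_iff.mp (by omega)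
  set σ : K →+* ℝ := (isReal_iff.mp (hreal k.val)).embedding with hσ
  have hmult : (mult k.val : ℝ) = 1 := by
    rw [mult, if_pos (hreal k.val)]; simp
  have hlog0 : 0 < Real.log ε₀ := Real.log_pos hε₀
  -- (1) the regulator is `|log |σ u₀||` for the fundamental unit `u₀`
  set u₀ : (𝓞 K)ˣ := fundSystem K (e k) with hu₀
  have hreg : regulator K = |Real.log (|σ ((u₀ : 𝓞 K) : K)|)| := by
    rw [regulator_eq_det K w' e, Matrix.det_eq_elem_of_card_eq_one hc1 k, Matrix.of_apply, hmult,
      one_mul, infinitePlace_apply_eq_abs (hreal k.val)]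
  -- (2) lower bound
  have hlow : Real.log ε₀ ≤ regulator K := by
    rw [hreg]
    apply log_le_abs_log_of_minimal b hb hω (by linarith) hmin σ u₀
    intro h1
    have := regulator_pos K
    rw [hreg, h1, Real.log_one, abs_zero] at this
    exact lt_irrefl _ this
  -- (3) upper bound from the family `(ε)`
  set u : Fin (rank K) → (𝓞 K)ˣ := fun _ => ε with hu
  have hregu : regOfFamily u = Real.log ε₀ := by
    rw [regOfFamily_eq_det u w' e, Matrix.det_eq_elem_of_card_eq_one hc1 k, Matrix.of_apply, hmult,
      one_mul, infinitePlace_apply_eq_abs (hreal k.val), hu]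
    exact hε σ
  have hidx := regOfFamily_div_regulator u
  rw [hregu] at hidx
  have hRpos := regulator_pos K
  have hn : (1 : ℝ) ≤ ((Subgroup.closure (Set.range u) ⊔ torsion K).index : ℝ) := by
    have hne : (Subgroup.closure (Set.range u) ⊔ torsion K).index ≠ 0 := by
      intro h0
      rw [h0, Nat.cast_zero, div_eq_zero_iff] at hidx
      rcases hidx with h | h
      · exact hlog0.ne' h
      · exact hRpos.ne' h
    exact_mod_cast Nat.one_le_iff_ne_zero.mpr hne
  have hup : regulator K ≤ Real.log ε₀ := by
    rw [← hidx, le_div_iff₀ hRpos, one_mul] at hn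
    exact hn
  exact le_antisymm hup hlow

end Regulator

/-! ### The fields of discriminant `21` and `33` -/

section TwentyOne

variable (b : Basis (Fin 2) ℤ (𝓞 K)) (hb : b 0 = 1) {t m : ℤ}

omit [NumberField K] in
/-- `t` is odd when `t² + 4m = 21`. [folklore] -/
theorem odd_t_of_eq_21 (hd : t ^ 2 + 4 * m = 21) : t % 2 = 1 := by
  rcases Int.emod_two_eq_zero_or_one t with h | h
  · exfalso
    obtain ⟨s, hs⟩ : ∃ s, t = 2 * s := ⟨t / 2, by omega⟩
    subst hs
    have : (4 * (s ^ 2 + m) : ℤ) = 21 := by linarith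
    omega
  · exact h

/-- The unit `ε₂₁ = (5 - t)/2 + ω` (`= (5 + √21)/2` under `ω ↦ (t + √21)/2`) of the field of
discriminant `t² + 4m = 21`, with inverse `(5 + t)/2 - ω`. [cite: BakerWustholz2007, §3.1 p. 36] -/
def unit21 (hω : b 1 * b 1 = (m : 𝓞 K) + (t : 𝓞 K) * b 1) (hd : t ^ 2 + 4 * m = 21) : (𝓞 K)ˣ where
  val := (((5 - t) / 2 : ℤ) : 𝓞 K) + b 1
  inv := (((5 + t) / 2 : ℤ) : 𝓞 K) - b 1
  val_inv := by
    have ht := odd_t_of_eq_21 hd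
    obtain ⟨s, hs⟩ : ∃ s, t = 2 * s + 1 := ⟨t / 2, by omega⟩
    have h1 : (5 - t) / 2 = 2 - s := by omega
    have h2 : (5 + t) / 2 = 3 + s := by omega
    have hm : m = 5 - s ^ 2 - s := by subst hs; nlinarith
    rw [h1, h2]
    subst hm hs
    push_cast at hω ⊢
    linear_combination (-1 : 𝓞 K) * hω
  inv_val := by
    have ht := odd_t_of_eq_21 hd
    obtain ⟨s, hs⟩ : ∃ s, t = 2 * s + 1 := ⟨t / 2, by omega⟩
    have h1 : (5 - t) / 2 = 2 - s := by omega
    have h2 : (5 + t) / 2 = 3 + s := by omega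
    have hm : m = 5 - s ^ 2 - s := by subst hs; nlinarith
    rw [h1, h2]
    subst hm hs
    push_cast at hω ⊢
    linear_combination (-1 : 𝓞 K) * hω

/-- `|log |σ ε₂₁|| = log ((5 + √21)/2)` for every real embedding (`σ ε₂₁ = (5 ± √21)/2`).
[cite: BakerWustholz2007, §3.1 p. 36] -/
theorem abs_log_unit21 (hω : b 1 * b 1 = (m : 𝓞 K) + (t : 𝓞 K) * b 1) (hd : t ^ 2 + 4 * m = 21)
    (σ : K →+* ℝ) :
    |Real.log (|σ ((unit21 b hω hd : 𝓞 K) : K)|)| = Real.log ((5 + Real.sqrt 21) / 2) := by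
  have ht := odd_t_of_eq_21 hd
  set δ : ℝ := 2 * σ (b 1 : K) - t with hδ
  have hδ2 : δ ^ 2 = 21 := by
    have := ringHom_delta_sq b hω σ; rw [hd] at this; exact_mod_cast this
  have hval : σ ((unit21 b hω hd : 𝓞 K) : K) = (5 + δ) / 2 := by
    have h : σ ((unit21 b hω hd : 𝓞 K) : K) = (((5 - t) / 2 : ℤ) : ℝ) + σ (b 1 : K) := by
      show σ (algebraMap (𝓞 K) K ((((5 - t) / 2 : ℤ) : 𝓞 K) + b 1)) = _
      rw [map_add, map_add, map_intCast, map_intCast]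
    rw [h, hδ]
    have h1 : (((5 - t) / 2 : ℤ) : ℝ) = (5 - t) / 2 := by
      obtain ⟨s, hs⟩ : ∃ s, t = 2 * s + 1 := ⟨t / 2, by omega⟩
      rw [show (5 - t) / 2 = 2 - s by omega, hs]; push_cast; ring
    rw [h1]; ring
  have hs : Real.sqrt 21 ^ 2 = 21 := Real.sq_sqrt (by norm_num)
  have hs4 : (4 : ℝ) < Real.sqrt 21 := by nlinarith [Real.sqrt_nonneg 21]
  have hs5 : Real.sqrt 21 < 5 := by nlinarith [Real.sqrt_nonneg 21]
  have hεpos : 0 < (5 + Real.sqrt 21) / 2 := by positivity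
  have hcases : δ = Real.sqrt 21 ∨ δ = -Real.sqrt 21 := by
    have : δ ^ 2 = Real.sqrt 21 ^ 2 := by rw [hδ2, hs]
    exact sq_eq_sq_iff_eq_or_eq_neg.mp this
  rcases hcases with h | h
  · rw [hval, h, abs_of_pos hεpos, abs_of_pos (Real.log_pos (by nlinarith))]
  · rw [hval, h]
    have hinv : (5 + -Real.sqrt 21) / 2 = ((5 + Real.sqrt 21) / 2)⁻¹ := by
      exact eq_inv_of_mul_eq_one_left (by nlinarith)
    rw [hinv, abs_of_pos (inv_pos.mpr hεpos), Real.log_inv, abs_neg,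
      abs_of_pos (Real.log_pos (by nlinarith))]

include hb in
/-- **`R(ℚ(√21)) = log ((5 + √21)/2)`**: the regulator of the quadratic field of discriminant
`21`. [cite: BakerWustholz2007, §3.1 p. 36] -/
theorem regulator_eq_log_21 (h2 : finrank ℚ K = 2) (hdisc : NumberField.discr K = 21) :
    regulator K = Real.log ((5 + Real.sqrt 21) / 2) := by
  set t := b.repr (b 1 * b 1) 1
  set m := b.repr (b 1 * b 1) 0
  have hω := basis_one_mul_self_eq b hb
  have hd : t ^ 2 + 4 * m = 21 := by rw [← hdisc, discr_eq_sq_add_four_mul b hb]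
  have hs4 : (4 : ℝ) < Real.sqrt 21 := by
    have hs : Real.sqrt 21 ^ 2 = 21 := Real.sq_sqrt (by norm_num); nlinarith [Real.sqrt_nonneg 21]
  refine regulator_eq_log_of_minimal b hb h2 (by rw [hdisc]; norm_num) hω (by linarith)
    (fun X Y hX hY hXY => ?_) (unit21 b hω hd) (abs_log_unit21 b hω hd)
  rw [hd] at hXY ⊢
  exact_mod_cast sqrt21_min hX hY hXY

end TwentyOne

section ThirtyThree

variable (b : Basis (Fin 2) ℤ (𝓞 K)) (hb : b 0 = 1) {t m : ℤ}

/-- The unit `ε₃₃ = (23 - 4t) + 8ω` (`= 23 + 4√33` under `ω ↦ (t + √33)/2`) of the field of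
discriminant `t² + 4m = 33`, with inverse `(23 + 4t) - 8ω`. [cite: BakerWustholz2007, §3.1 p. 36] -/
def unit33 (hω : b 1 * b 1 = (m : 𝓞 K) + (t : 𝓞 K) * b 1) (hd : t ^ 2 + 4 * m = 33) : (𝓞 K)ˣ where
  val := ((23 - 4 * t : ℤ) : 𝓞 K) + 8 * b 1
  inv := ((23 + 4 * t : ℤ) : 𝓞 K) - 8 * b 1
  val_inv := by
    have hm : ((4 * m : ℤ) : 𝓞 K) = ((33 - t ^ 2 : ℤ) : 𝓞 K) := by congr 1; linarith
    push_cast at hω hm ⊢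
    linear_combination (-64 : 𝓞 K) * hω + (-16 : 𝓞 K) * hm
  inv_val := by
    have hm : ((4 * m : ℤ) : 𝓞 K) = ((33 - t ^ 2 : ℤ) : 𝓞 K) := by congr 1; linarith
    push_cast at hω hm ⊢
    linear_combination (-64 : 𝓞 K) * hω + (-16 : 𝓞 K) * hm

/-- `|log |σ ε₃₃|| = log (23 + 4√33)` for every real embedding. [cite: BakerWustholz2007, §3.1 p. 36] -/
theorem abs_log_unit33 (hω : b 1 * b 1 = (m : 𝓞 K) + (t : 𝓞 K) * b 1) (hd : t ^ 2 + 4 * m = 33)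
    (σ : K →+* ℝ) :
    |Real.log (|σ ((unit33 b hω hd : 𝓞 K) : K)|)| = Real.log (23 + 4 * Real.sqrt 33) := by
  set δ : ℝ := 2 * σ (b 1 : K) - t with hδ
  have hδ2 : δ ^ 2 = 33 := by
    have := ringHom_delta_sq b hω σ; rw [hd] at this; exact_mod_cast this
  have hval : σ ((unit33 b hω hd : 𝓞 K) : K) = 23 + 4 * δ := by
    have h : σ ((unit33 b hω hd : 𝓞 K) : K) = ((23 - 4 * t : ℤ) : ℝ) + 8 * σ (b 1 : K) := by
      show σ (algebraMap (𝓞 K) K (((23 - 4 * t : ℤ) : 𝓞 K) + 8 * b 1)) = _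
      rw [map_add, map_add, map_intCast, map_intCast, map_mul, map_mul, map_ofNat, map_ofNat]
    rw [h, hδ]; push_cast; ring
  have hs : Real.sqrt 33 ^ 2 = 33 := Real.sq_sqrt (by norm_num)
  have hs5 : (5 : ℝ) < Real.sqrt 33 := by nlinarith [Real.sqrt_nonneg 33]
  have hs6 : Real.sqrt 33 < 6 := by nlinarith [Real.sqrt_nonneg 33]
  have hεpos : 0 < 23 + 4 * Real.sqrt 33 := by positivity
  have hcases : δ = Real.sqrt 33 ∨ δ = -Real.sqrt 33 := by
    have : δ ^ 2 = Real.sqrt 33 ^ 2 := by rw [hδ2, hs]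
    exact sq_eq_sq_iff_eq_or_eq_neg.mp this
  rcases hcases with h | h
  · rw [hval, h, abs_of_pos hεpos, abs_of_pos (Real.log_pos (by nlinarith))]
  · rw [hval, h]
    have hinv : 23 + 4 * -Real.sqrt 33 = (23 + 4 * Real.sqrt 33)⁻¹ := by
      exact eq_inv_of_mul_eq_one_left (by nlinarith)
    rw [hinv, abs_of_pos (inv_pos.mpr hεpos), Real.log_inv, abs_neg,
      abs_of_pos (Real.log_pos (by nlinarith))]

include hb in
/-- **`R(ℚ(√33)) = log (23 + 4√33)`**: the regulator of the quadratic field of discriminant `33`.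
[cite: BakerWustholz2007, §3.1 p. 36] -/
theorem regulator_eq_log_33 (h2 : finrank ℚ K = 2) (hdisc : NumberField.discr K = 33) :
    regulator K = Real.log (23 + 4 * Real.sqrt 33) := by
  set t := b.repr (b 1 * b 1) 1
  set m := b.repr (b 1 * b 1) 0
  have hω := basis_one_mul_self_eq b hb
  have hd : t ^ 2 + 4 * m = 33 := by rw [← hdisc, discr_eq_sq_add_four_mul b hb]
  have hs5 : (5 : ℝ) < Real.sqrt 33 := by
    have hs : Real.sqrt 33 ^ 2 = 33 := Real.sq_sqrt (by norm_num); nlinarith [Real.sqrt_nonneg 33]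
  refine regulator_eq_log_of_minimal b hb h2 (by rw [hdisc]; norm_num) hω (by linarith)
    (fun X Y hX hY hXY => ?_) (unit33 b hω hd) (abs_log_unit33 b hω hd)
  rw [hd] at hXY ⊢
  have := sqrt33_min hX hY hXY
  push_cast
  linarith

end ThirtyThree

end Literature.NumberTheory.QuadraticFields.Quadratic

end
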